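import Summits.QuantumFields.YangMills.Theorems.SqueezedSkewnessFemtoCeiling
import Summits.QuantumFields.YangMills.Theorems.BalabanLadderInfVolRPSquare
import HarnessLib

/-!
# Route `SqueezedSkewness`, support `CollarBumpFloors` (stmt-QuantumFields-23680) — the electric cross term

Helper file (`--supports stmt-QuantumFields-19353`, fleet lead `ym-spine-19353-p1` g20) for the by-name proof of
`CollarBumpFloors` (LINE χ₂ «femto currency» of planner ym-idea-6 g12).  The landed `ThermalDescent.TransportIdentity` writes the
route's reflection form on the hypercube `(2L+1)⁴` as `Qrp(f) = Q2(θf, f) − Cov_P(D_f ∘ refl, B_f)`, `D_f = Σₓ [f(s x + s e₀) − f(s x)]·A^el_x`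
the electric corner discrepancy.  This file bounds the CROSS TERM from the plane-resolved collar output `MomentBounds6` (= the landed
`stub_collar6` applied to `FBL6`):

  `|Cov_P(D_f ∘ refl, B_f)| ≤ 18 · (C/R⁴)² · (Σₓ |f(s x + s e₀) − f(s x)|) · (Σ_y |f(s y)|)`

whenever `f` is supported in a slab `{δ₁ < y₀ < δ₂}` with `2R + 4 ≤ 2(δ₁ − s)/s` and `2|δ₂| + 1 ≤ sL` (`abs_cross_le`).  Ingredients:
the reflected `Fin`-torus ↔ `torusE` dictionary (`AntipodalMarkovDictionary.covF_toFin_reflF`, `toFin_dens_zOf`, and the electric-plane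
transport `toFin_eplane_zOf` from `ThermalDescentSeamFromMoments.plane_eplane_zOf`), the exact reflection law of the plane fields
(`InfVolRP.plane_cfgReflect`: electric plaquettes hang one unit lower), bilinearity (`UniversalDetectorPlaneTight.cov_sum_mul_sum`) and the
`n = 2` collar output for a plane pair (`FemtoCeilingProof.abs_cov_plane_le`).  With `Σ|df| = O(s⁻³)`, `Σ|f| = O(s⁻⁴)` and `R ≍ s⁻¹` the bound
is `O(s)`: the seam is invisible at the floor scale.

HONEST FRAMING: finite-lattice bookkeeping under the HYPOTHESIS `MomentBounds6` at one coupling; no floor, no boundary law, no NT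
statement (stmt-QuantumFields-19353) and no mass gap is proved here. [folklore]
-/

set_option autoImplicit false

noncomputable section
open MeasureTheory Filter Topology
open Literature.MathematicalPhysics.QuantumFieldTheory Literature.MathematicalPhysics.QuantumLattice
open Literature.Probability.LatticeModels (box)
open Summit.QuantumFields.YangMills.Cruxes.OSLegsFromFemtoAndGap.DlrCollarTransfer
open Summit.QuantumFields.YangMills.Theorems.ThermalDescentTorusDictionary (eF aF wF zOf ccZ sum_box_eq_sum_fin)
open Summit.QuantumFields.YangMills.Theorems.ThermalDescentCornerCov (posZ)
open Summit.QuantumFields.YangMills.Theorems.ThermalDescentCornerCov (eq_zero_of_window)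
open Summit.QuantumFields.YangMills.Theorems.ThermalDescentSeamFromMoments
  (window_of_sub_ne_zero zOf_apply_zero smul_posZ_apply_zero plane_eplane_zOf eplane_lt)
open Summit.QuantumFields.YangMills.Theorems.AntipodalMarkovDictionary (covF_toFin_reflF toFin_dens_zOf configPerm_symm_apply')
open Summit.QuantumFields.YangMills.Cruxes.UniversalDetectorPlaneTight (cov_sum_mul_sum dens_eq_sum_plane_univ)
open Summit.QuantumFields.YangMills.Cruxes.NT.MarkovMirror (torusE_const_mul continuous_cfgReflect)
open Summit.QuantumFields.YangMills.Theorems.FemtoCeilingProof (abs_cov_plane_le)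
open Summit.QuantumFields.YangMills.Theorems.InfVolRP (reflSite plane_cfgReflect reflSite_apply_zero)

namespace Summit.QuantumFields.YangMills.Theorems.CollarBumpCross

variable (G : Type) [Group G] [TopologicalSpace G] [IsTopologicalGroup G] [CompactSpace G]
  [MeasurableSpace G] [BorelSpace G] (r : LatticeRep G)

/-! ## §1 Transport of the electric plane field -/

omit [BorelSpace G] in
/-- **The electric plane field transports to the electric plaquette**: `toFin (plane (0, k+1) (zOf u)) = P^{k3}_u`. [folklore] -/
theorem toFin_eplane_zOf (L : ℕ) (k : Fin 3) (u : FinTorusSite (2 * L + 1) (2 * L + 1) (2 * L + 1) (2 * L + 1)) :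
    (fun V => (plane G r ((0 : Fin 4), k.succ) (zOf (2 * L + 1) u))
      (torusLift (2 * L + 1) (configPerm (finRotate 4) ((finTorusConfigEquivSite G (2 * L + 1)).symm V)))) =
      fun V => (r.ρ (finTorusPlaquette V u k.castSucc (Fin.last 3))).trace.re := by
  funext V
  obtain ⟨U, rfl⟩ : ∃ U, V = finTorusConfigEquivSite G (2 * L + 1) U :=
    ⟨(finTorusConfigEquivSite G (2 * L + 1)).symm V, by simp⟩
  rw [MeasurableEquiv.symm_apply_apply, plane_eplane_zOf, configPerm_symm_apply']

/-! ## §2 One reflected electric plane against one density: the `n = 2` collar output -/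

/-- **Separation of a charged cross pair.**  On the odd torus `(2L+1)⁴` with `2|δ₂| + 1 ≤ sL`, `0 < s ≤ 1`: two centred times
`t_x, t_y` with `δ₁ − s < s t < δ₂` and a collar radius with `2R + 4 ≤ 2(δ₁ − s)/s` give `2R + 4 ≤ t_y + t_x + 1 ≤ L`, hence the
cyclic separation `≥ 2R + 4` between the time `−t_x − 1` of the reflected electric plaquette and `t_y`. [folklore] -/
theorem sep_cross {δ₁ δ₂ s : ℝ} {L R : ℕ} (hs : 0 < s) (hs1 : s ≤ 1) (hL : 2 * |δ₂| + 1 ≤ s * L)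
    (hR : (2 * R + 4 : ℝ) ≤ 2 * (δ₁ - s) / s) (tx ty : ℤ)
    (hx : δ₁ - s < s * (tx : ℝ) ∧ s * (tx : ℝ) < δ₂) (hy : δ₁ - s < s * (ty : ℝ) ∧ s * (ty : ℝ) < δ₂) :
    (2 * (R : ℤ) + 4) ≤ |((((ty + tx + 1 : ℤ) : ZMod (2 * L + 1))).valMinAbs : ℤ)| := by
  have h1 : 2 * (δ₁ - s) / s < (tx : ℝ) + ty := by
    rw [div_lt_iff₀ hs]; linarith [hx.1, hy.1]
  have hm_ge : (2 * R + 4 : ℝ) < ((ty + tx + 1 : ℤ) : ℝ) := by push_cast; linarith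
  have hm_le : ((ty + tx + 1 : ℤ) : ℝ) < L := by
    have e1 : s * ((ty : ℝ) + tx + 1) = s * ty + s * tx + s := by ring
    have h2 : s * ((ty : ℝ) + tx + 1) < s * L := by rw [e1]; linarith [hx.2, hy.2, le_abs_self δ₂]
    push_cast
    exact lt_of_mul_lt_mul_left h2 hs.le
  have hm_pos : (0 : ℝ) < ((ty + tx + 1 : ℤ) : ℝ) := by
    have : (0 : ℝ) ≤ 2 * R + 4 := by positivity
    linarith
  have hmL : ty + tx + 1 ≤ L := by exact_mod_cast hm_le.le
  have hm0 : 0 < ty + tx + 1 := by exact_mod_cast hm_pos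
  have hval : (((ty + tx + 1 : ℤ) : ZMod (2 * L + 1))).valMinAbs = ty + tx + 1 := by
    rw [ZMod.valMinAbs_spec]
    exact ⟨rfl, by push_cast; omega, by push_cast; omega⟩
  rw [hval, abs_of_pos hm0]
  exact_mod_cast hm_ge.le

/-- Covariance against a finite sum of continuous observables (one-sided bilinearity). [folklore] -/
theorem cov_mul_sum (β : ℝ) (L : ℕ) {κ : Type} [Fintype κ] (f : LGConfig 4 G → ℝ) (g : κ → LGConfig 4 G → ℝ)
    (hf : Continuous f) (hg : ∀ j, Continuous (g j)) :
    torusE G r β L (fun V => f V * ∑ j, g j V) - torusE G r β L f * torusE G r β L (fun V => ∑ j, g j V) =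
      ∑ j, (torusE G r β L (fun V => f V * g j V) - torusE G r β L f * torusE G r β L (g j)) := by
  have h := cov_sum_mul_sum r β L (fun _ : Fin 1 => f) g (fun _ => hf) hg
  simp only [Finset.univ_unique, Fin.default_eq_zero, Finset.sum_singleton] at h
  exact h

/-- **A reflected electric plane field against a density** (`X, Y ∈ ℤ⁴`): if the centred times satisfy
`2R+4 ≤ |Y₀ + X₀ + 1| (mod 2L+1)`, then `|Cov_T(plane_{(0,k+1)} X ∘ Θ₀, dens Y)| ≤ 6 (C/R⁴)²` under the `n`-point collar output at
`(β, L, R, C)`: the electric plane of the reflected field is the electric plane at `θX − e₀` (`plane_cfgReflect`), the density is the sum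
of its six planes, and each plane pair is `≤ (C/R⁴)²` (`abs_cov_plane_le`). [folklore] -/
theorem abs_cov_eplane_reflect_dens_le (β : ℝ) (L : ℕ) {C : ℝ} {R : ℕ}
    (H : ∀ (n : ℕ) (q : Fin n → Fin 4 × Fin 4) (x : Fin n → (Fin 4 → ℤ)), (∀ i, (q i).1 < (q i).2) →
      (∀ i j : Fin n, i ≠ j → ∃ k : Fin 4,
        (2 * (R : ℤ) + 4) ≤ |((((x i k - x j k : ℤ) : ZMod (2 * L + 1))).valMinAbs : ℤ)|) →
      |torusE G r β L (fun U => ∏ i, (plane G r (q i) (x i) U - torusE G r β L (plane G r (q i) (x i))))| ≤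
        (C / (R : ℝ) ^ 4) ^ n)
    (k : Fin 3) (X Y : Fin 4 → ℤ)
    (hsep : (2 * (R : ℤ) + 4) ≤ |((((Y 0 + X 0 + 1 : ℤ) : ZMod (2 * L + 1))).valMinAbs : ℤ)|) :
    |torusE G r β L (fun W => plane G r ((0 : Fin 4), k.succ) X (cfgReflect W) * dens G r Y W) -
        torusE G r β L (fun W => plane G r ((0 : Fin 4), k.succ) X (cfgReflect W)) * torusE G r β L (dens G r Y)| ≤
      6 * (C / (R : ℝ) ^ 4) ^ 2 := by
  have hq : (((0 : Fin 4), k.succ) : Fin 4 × Fin 4).1 < (((0 : Fin 4), k.succ) : Fin 4 × Fin 4).2 := eplane_lt k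
  set X' : Fin 4 → ℤ := reflSite ((0 : Fin 4), k.succ) X with hX'
  have hrefl : (fun W => plane G r ((0 : Fin 4), k.succ) X (cfgReflect W)) = plane G r ((0 : Fin 4), k.succ) X' := by
    funext W; rw [hX']; exact plane_cfgReflect r hq X W
  have hX'0 : X' 0 = -X 0 - 1 := by
    rw [hX', reflSite_apply_zero]; simp
  have hsep' : (2 * (R : ℤ) + 4) ≤ |((((X' 0 - Y 0 : ℤ) : ZMod (2 * L + 1))).valMinAbs : ℤ)| := by
    have h : ((X' 0 - Y 0 : ℤ) : ZMod (2 * L + 1)) = -((Y 0 + X 0 + 1 : ℤ) : ZMod (2 * L + 1)) := by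
      rw [hX'0]; push_cast; ring
    rw [h, Int.abs_eq_natAbs, ZMod.natAbs_valMinAbs_neg, ← Int.abs_eq_natAbs]
    exact hsep
  obtain ⟨g, hg⟩ : ∃ g : {q : Fin 4 × Fin 4 // q.1 < q.2} → LGConfig 4 G → ℝ, g = fun q => plane G r q.1 Y := ⟨_, rfl⟩
  have hgc : ∀ q, Continuous (g q) := fun q => by rw [hg]; exact continuous_plane r _ _
  have hdens : dens G r Y = fun W => ∑ q : {q : Fin 4 × Fin 4 // q.1 < q.2}, g q W := by
    funext W; rw [dens_eq_sum_plane_univ, hg]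
  have hprod : (fun W => plane G r ((0 : Fin 4), k.succ) X (cfgReflect W) * dens G r Y W) =
      fun W => plane G r ((0 : Fin 4), k.succ) X' W * ∑ q : {q : Fin 4 × Fin 4 // q.1 < q.2}, g q W := by
    funext W; rw [← congrFun hrefl W, hdens]
  rw [hprod, hrefl, hdens, cov_mul_sum G r β L (plane G r ((0 : Fin 4), k.succ) X') g (continuous_plane r _ _) hgc]
  refine (Finset.abs_sum_le_sum_abs _ _).trans ?_
  have hterm : ∀ q ∈ (Finset.univ : Finset {q : Fin 4 × Fin 4 // q.1 < q.2}),
      |torusE G r β L (fun W => plane G r ((0 : Fin 4), k.succ) X' W * g q W) -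
        torusE G r β L (plane G r ((0 : Fin 4), k.succ) X') * torusE G r β L (g q)| ≤ (C / (R : ℝ) ^ 4) ^ 2 := by
    intro q _
    rw [hg]
    exact abs_cov_plane_le G r β L H ⟨((0 : Fin 4), k.succ), hq⟩ q X' Y hsep'
  refine (Finset.sum_le_sum hterm).trans ?_
  rw [Finset.sum_const, Finset.card_univ, show Fintype.card {q : Fin 4 × Fin 4 // q.1 < q.2} = 6 by decide,
    nsmul_eq_mul]
  norm_num

/-! ## §3 The smeared cross term `Cov_P(D_f ∘ refl, B_f)` -/

/-- **The electric cross term of the reflection form is controlled by the collar output.**  On the odd torus `(2L+1)⁴` with the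
normalised Wilson weight, for a test function `f` supported in the slab `{δ₁ < y₀ < δ₂}`, spacing `0 < s ≤ 1`, `2|δ₂| + 1 ≤ sL` and a
collar radius with `2R + 4 ≤ 2(δ₁ − s)/s`: under the `n`-point collar output at `(β, L, R, C)`,
`|Cov_P(D_f ∘ refl, B_f)| ≤ 18 (C/R⁴)² · Σₓ|f(s x + s e₀) − f(s x)| · Σ_y |f(s y)|` (`D_f` = the electric corner discrepancy,
`B_f` = the smeared plaquette field, `refl` = the route's link reflection).  Each charged pair (a difference weight at `x`, a weight
at `y`) has centred times with `Y₀ + X₀ + 1 ≥ 2R + 4` and `≤ L` (`sep_cross`), so `abs_cov_eplane_reflect_dens_le` applies termwise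
after the reflected dictionary and the bilinear expansion over (site, electric direction) × site. [folklore] -/
theorem abs_cross_le (β : ℝ) (L : ℕ) {C : ℝ} {R : ℕ}
    (H : ∀ (n : ℕ) (q : Fin n → Fin 4 × Fin 4) (x : Fin n → (Fin 4 → ℤ)), (∀ i, (q i).1 < (q i).2) →
      (∀ i j : Fin n, i ≠ j → ∃ k : Fin 4,
        (2 * (R : ℤ) + 4) ≤ |((((x i k - x j k : ℤ) : ZMod (2 * L + 1))).valMinAbs : ℤ)|) →
      |torusE G r β L (fun U => ∏ i, (plane G r (q i) (x i) U - torusE G r β L (plane G r (q i) (x i))))| ≤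
        (C / (R : ℝ) ^ 4) ^ n)
    {s δ₁ δ₂ : ℝ} (hs : 0 < s) (hs1 : s ≤ 1) (f : SchwartzMap (EuclideanSpace ℝ (Fin 4)) ℝ)
    (hf : tsupport (f : EuclideanSpace ℝ (Fin 4) → ℝ) ⊆ {y : EuclideanSpace ℝ (Fin 4) | δ₁ < y 0 ∧ y 0 < δ₂})
    (hL : 2 * |δ₂| + 1 ≤ s * L) (hR : (2 * R + 4 : ℝ) ≤ 2 * (δ₁ - s) / s)
    {Sd Sc : ℝ}
    (hSd : ∑ x : FinTorusSite (2 * L + 1) (2 * L + 1) (2 * L + 1) (2 * L + 1),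
      |f (s • posZ (2 * L + 1) x + s • EuclideanSpace.single (0 : Fin 4) (1 : ℝ)) - f (s • posZ (2 * L + 1) x)| ≤ Sd)
    (hSc : ∑ y : FinTorusSite (2 * L + 1) (2 * L + 1) (2 * L + 1) (2 * L + 1), |f (s • posZ (2 * L + 1) y)| ≤ Sc) :
    |eF r β (2 * L + 1) (fun V =>
        (∑ x, (f (s • posZ (2 * L + 1) x + s • EuclideanSpace.single (0 : Fin 4) (1 : ℝ)) - f (s • posZ (2 * L + 1) x)) *
          ∑ k : Fin 3, (r.ρ (finTorusPlaquette (fun e => if e.2 = Fin.last 3 then (V ((e.1.1, e.1.2.1, e.1.2.2.1, Fin.rev e.1.2.2.2), Fin.last 3))⁻¹ else V ((e.1.1, e.1.2.1, e.1.2.2.1, ⟨((2 * L + 1) - e.1.2.2.2.val) % (2 * L + 1), Nat.mod_lt _ e.1.2.2.2.pos⟩), e.2)) x k.castSucc (Fin.last 3))).trace.re) *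
        ∑ y, f (s • posZ (2 * L + 1) y) * aF r y V) -
      eF r β (2 * L + 1) (fun V =>
        ∑ x, (f (s • posZ (2 * L + 1) x + s • EuclideanSpace.single (0 : Fin 4) (1 : ℝ)) - f (s • posZ (2 * L + 1) x)) *
          ∑ k : Fin 3, (r.ρ (finTorusPlaquette (fun e => if e.2 = Fin.last 3 then (V ((e.1.1, e.1.2.1, e.1.2.2.1, Fin.rev e.1.2.2.2), Fin.last 3))⁻¹ else V ((e.1.1, e.1.2.1, e.1.2.2.1, ⟨((2 * L + 1) - e.1.2.2.2.val) % (2 * L + 1), Nat.mod_lt _ e.1.2.2.2.pos⟩), e.2)) x k.castSucc (Fin.last 3))).trace.re) *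
      eF r β (2 * L + 1) (fun V => ∑ y, f (s • posZ (2 * L + 1) y) * aF r y V)| ≤
      18 * (C / (R : ℝ) ^ 4) ^ 2 * Sd * Sc := by
  -- the weights
  obtain ⟨d, hd⟩ : ∃ d : FinTorusSite (2 * L + 1) (2 * L + 1) (2 * L + 1) (2 * L + 1) → ℝ, d = fun x =>
    f (s • posZ (2 * L + 1) x + s • EuclideanSpace.single (0 : Fin 4) (1 : ℝ)) - f (s • posZ (2 * L + 1) x) := ⟨_, rfl⟩
  obtain ⟨c, hc⟩ : ∃ c : FinTorusSite (2 * L + 1) (2 * L + 1) (2 * L + 1) (2 * L + 1) → ℝ,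
    c = fun y => f (s • posZ (2 * L + 1) y) := ⟨_, rfl⟩
  have hB0 : 0 ≤ (C / (R : ℝ) ^ 4) ^ 2 := sq_nonneg _
  have hSd0 : 0 ≤ Sd := le_trans (Finset.sum_nonneg fun _ _ => abs_nonneg _) hSd
  have hSc0 : 0 ≤ Sc := le_trans (Finset.sum_nonneg fun _ _ => abs_nonneg _) hSc
  -- separation of the charged pairs
  have hpair : ∀ (x y : FinTorusSite (2 * L + 1) (2 * L + 1) (2 * L + 1) (2 * L + 1)) (k : Fin 3), d x ≠ 0 → c y ≠ 0 →
      |torusE G r β L (fun W => plane G r ((0 : Fin 4), k.succ) (zOf (2 * L + 1) x) (cfgReflect W) * dens G r (zOf (2 * L + 1) y) W) -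
        torusE G r β L (fun W => plane G r ((0 : Fin 4), k.succ) (zOf (2 * L + 1) x) (cfgReflect W)) *
          torusE G r β L (dens G r (zOf (2 * L + 1) y))| ≤ 6 * (C / (R : ℝ) ^ 4) ^ 2 := by
    intro x y k hx hy
    rw [hd] at hx
    rw [hc] at hy
    refine abs_cov_eplane_reflect_dens_le G r β L H k _ _ ?_
    have wx := window_of_sub_ne_zero hf hs x hx
    rw [← zOf_apply_zero] at wx
    have wy : δ₁ < s * (zOf (2 * L + 1) y 0 : ℝ) ∧ s * (zOf (2 * L + 1) y 0 : ℝ) < δ₂ := by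
      by_contra hcon
      apply hy
      apply eq_zero_of_window hf
      rw [smul_posZ_apply_zero, ← zOf_apply_zero]
      exact hcon
    exact sep_cross hs hs1 hL hR (zOf (2 * L + 1) x 0) (zOf (2 * L + 1) y 0) wx ⟨by linarith [wy.1], wy.2⟩
  -- the `ℤ⁴` observables and their transports
  obtain ⟨ΦD, hΦD⟩ : ∃ ΦD : LGConfig 4 G → ℝ,
      ΦD = fun W => ∑ x, d x * ∑ k : Fin 3, plane G r ((0 : Fin 4), k.succ) (zOf (2 * L + 1) x) W := ⟨_, rfl⟩
  obtain ⟨Φ, hΦ⟩ : ∃ Φ : LGConfig 4 G → ℝ, Φ = fun W => ∑ y, c y * dens G r (zOf (2 * L + 1) y) W := ⟨_, rfl⟩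
  have hB : ∀ V : FinTorusSite (2 * L + 1) (2 * L + 1) (2 * L + 1) (2 * L + 1) × Fin 4 → G,
      (∑ y, f (s • posZ (2 * L + 1) y) * aF r y V) =
        Φ (torusLift (2 * L + 1) (configPerm (finRotate 4) ((finTorusConfigEquivSite G (2 * L + 1)).symm V))) := by
    intro V
    rw [hΦ, hc]
    exact Finset.sum_congr rfl fun y _ => by rw [← congrFun (toFin_dens_zOf (G := G) r L y) V]
  have hDt : ∀ V : FinTorusSite (2 * L + 1) (2 * L + 1) (2 * L + 1) (2 * L + 1) × Fin 4 → G,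
      (∑ x, (f (s • posZ (2 * L + 1) x + s • EuclideanSpace.single (0 : Fin 4) (1 : ℝ)) - f (s • posZ (2 * L + 1) x)) *
          ∑ k : Fin 3, (r.ρ (finTorusPlaquette V x k.castSucc (Fin.last 3))).trace.re) =
        ΦD (torusLift (2 * L + 1) (configPerm (finRotate 4) ((finTorusConfigEquivSite G (2 * L + 1)).symm V))) := by
    intro V
    rw [hΦD, hd]
    refine Finset.sum_congr rfl fun x _ => ?_
    congr 1
    exact Finset.sum_congr rfl fun k _ => by rw [← congrFun (toFin_eplane_zOf G r L k x) V]
  simp only [hB, hDt]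
  rw [covF_toFin_reflF (G := G) r β L ΦD Φ]
  -- bilinear expansion over (site, electric direction) × site
  obtain ⟨F, hF⟩ : ∃ F : FinTorusSite (2 * L + 1) (2 * L + 1) (2 * L + 1) (2 * L + 1) × Fin 3 → LGConfig 4 G → ℝ,
      F = fun p W => d p.1 * plane G r ((0 : Fin 4), p.2.succ) (zOf (2 * L + 1) p.1) (cfgReflect W) := ⟨_, rfl⟩
  obtain ⟨Hg, hHg⟩ : ∃ Hg : FinTorusSite (2 * L + 1) (2 * L + 1) (2 * L + 1) (2 * L + 1) → LGConfig 4 G → ℝ,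
      Hg = fun y W => c y * dens G r (zOf (2 * L + 1) y) W := ⟨_, rfl⟩
  have hFc : ∀ p, Continuous (F p) := fun p => by
    rw [hF]; exact continuous_const.mul ((continuous_plane r _ _).comp continuous_cfgReflect)
  have hHc : ∀ y, Continuous (Hg y) := fun y => by rw [hHg]; exact continuous_const.mul (continuous_dens r _)
  have eD : (fun W => ΦD (cfgReflect W)) = fun W => ∑ p, F p W := by
    funext W
    simp only [hΦD, hF]
    symm
    rw [Fintype.sum_prod_type (f := fun p : FinTorusSite (2 * L + 1) (2 * L + 1) (2 * L + 1) (2 * L + 1) × Fin 3 =>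
      d p.1 * plane G r ((0 : Fin 4), p.2.succ) (zOf (2 * L + 1) p.1) (cfgReflect W))]
    exact Finset.sum_congr rfl fun x _ => by rw [Finset.mul_sum]
  have eB : Φ = fun W => ∑ y, Hg y W := by funext W; simp only [hΦ, hHg]
  have e1 : (fun W => ΦD (cfgReflect W) * Φ W) = fun W => (∑ p, F p W) * ∑ y, Hg y W := by
    funext W; rw [← congrFun eD W, eB]
  rw [e1, eD, eB, cov_sum_mul_sum r β L F Hg hFc hHc]
  -- termwise bound
  have hterm : ∀ (p : FinTorusSite (2 * L + 1) (2 * L + 1) (2 * L + 1) (2 * L + 1) × Fin 3)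
      (y : FinTorusSite (2 * L + 1) (2 * L + 1) (2 * L + 1) (2 * L + 1)),
      |torusE G r β L (fun W => F p W * Hg y W) - torusE G r β L (F p) * torusE G r β L (Hg y)| ≤
        |d p.1| * |c y| * (6 * (C / (R : ℝ) ^ 4) ^ 2) := by
    intro p y
    have e4 : (fun W => F p W * Hg y W) = fun W => (d p.1 * c y) *
        (plane G r ((0 : Fin 4), p.2.succ) (zOf (2 * L + 1) p.1) (cfgReflect W) * dens G r (zOf (2 * L + 1) y) W) := by
      funext W; simp only [hF, hHg]; ring
    rw [e4, show F p = fun W => d p.1 * plane G r ((0 : Fin 4), p.2.succ) (zOf (2 * L + 1) p.1) (cfgReflect W) by rw [hF],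
      show Hg y = fun W => c y * dens G r (zOf (2 * L + 1) y) W by rw [hHg],
      torusE_const_mul G r β L, torusE_const_mul G r β L, torusE_const_mul G r β L]
    have e5 : d p.1 * c y * torusE G r β L (fun W => plane G r ((0 : Fin 4), p.2.succ) (zOf (2 * L + 1) p.1) (cfgReflect W) *
          dens G r (zOf (2 * L + 1) y) W) -
        d p.1 * torusE G r β L (fun W => plane G r ((0 : Fin 4), p.2.succ) (zOf (2 * L + 1) p.1) (cfgReflect W)) *
          (c y * torusE G r β L (fun W => dens G r (zOf (2 * L + 1) y) W)) =
        (d p.1 * c y) * (torusE G r β L (fun W => plane G r ((0 : Fin 4), p.2.succ) (zOf (2 * L + 1) p.1) (cfgReflect W) *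
          dens G r (zOf (2 * L + 1) y) W) -
          torusE G r β L (fun W => plane G r ((0 : Fin 4), p.2.succ) (zOf (2 * L + 1) p.1) (cfgReflect W)) *
            torusE G r β L (dens G r (zOf (2 * L + 1) y))) := by ring
    rw [e5, abs_mul, abs_mul]
    by_cases hx : d p.1 = 0
    · rw [hx]; simp
    by_cases hy : c y = 0
    · rw [hy]; simp
    exact mul_le_mul_of_nonneg_left (hpair p.1 y p.2 hx hy) (by positivity)
  refine (Finset.abs_sum_le_sum_abs _ _).trans ?_
  refine (Finset.sum_le_sum fun p _ => (Finset.abs_sum_le_sum_abs _ _).trans (Finset.sum_le_sum fun y _ => hterm p y)).trans ?_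
  -- sum of the weights
  have hsum : ∑ p : FinTorusSite (2 * L + 1) (2 * L + 1) (2 * L + 1) (2 * L + 1) × Fin 3,
      ∑ y : FinTorusSite (2 * L + 1) (2 * L + 1) (2 * L + 1) (2 * L + 1), |d p.1| * |c y| * (6 * (C / (R : ℝ) ^ 4) ^ 2) =
      3 * (6 * (C / (R : ℝ) ^ 4) ^ 2) * (∑ x, |d x|) * ∑ y, |c y| := by
    have e6 : ∀ p : FinTorusSite (2 * L + 1) (2 * L + 1) (2 * L + 1) (2 * L + 1) × Fin 3,
        ∑ y, |d p.1| * |c y| * (6 * (C / (R : ℝ) ^ 4) ^ 2) = |d p.1| * ((6 * (C / (R : ℝ) ^ 4) ^ 2) * ∑ y, |c y|) := by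
      intro p
      rw [Finset.mul_sum, Finset.mul_sum]
      exact Finset.sum_congr rfl fun y _ => by ring
    have e7 : ∑ p : FinTorusSite (2 * L + 1) (2 * L + 1) (2 * L + 1) (2 * L + 1) × Fin 3, |d p.1| = 3 * ∑ x, |d x| := by
      rw [Fintype.sum_prod_type (f := fun p : FinTorusSite (2 * L + 1) (2 * L + 1) (2 * L + 1) (2 * L + 1) × Fin 3 => |d p.1|)]
      simp only [Finset.sum_const, Finset.card_univ, Fintype.card_fin, nsmul_eq_mul, Nat.cast_ofNat]
      rw [Finset.mul_sum]
    simp only [e6]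
    rw [← Finset.sum_mul, e7]
    ring
  rw [hsum]
  have hd1 : ∑ x, |d x| ≤ Sd := by rw [hd]; exact hSd
  have hc1 : ∑ y, |c y| ≤ Sc := by rw [hc]; exact hSc
  have hdn : 0 ≤ ∑ x, |d x| := Finset.sum_nonneg fun _ _ => abs_nonneg _
  have hcn : 0 ≤ ∑ y, |c y| := Finset.sum_nonneg fun _ _ => abs_nonneg _
  calc 3 * (6 * (C / (R : ℝ) ^ 4) ^ 2) * (∑ x, |d x|) * ∑ y, |c y|
      ≤ 3 * (6 * (C / (R : ℝ) ^ 4) ^ 2) * Sd * Sc :=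
        mul_le_mul (mul_le_mul_of_nonneg_left hd1 (by positivity)) hc1 hcn (by positivity)
    _ = 18 * (C / (R : ℝ) ^ 4) ^ 2 * Sd * Sc := by ring

end Summit.QuantumFields.YangMills.Theorems.CollarBumpCross

end
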